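import Summits.HubbardSuperconductivity.HubbardSuperconductivity.Theorems.NodalWardXYDefs
import Literature.Probability.LatticeModels.PlaneRotatorLROProofs

/-!
# drefute `schwarz-inheritance` — checked proofs of four stubs of the line skeleton

Crux `PerturbedXYOrder` (stmt-HubbardSuperconductivity-10739), line `Lines/schwarz-inheritance.lean` (skeleton 3a8fe397).
Seat refuter-drefute-stmt-HubbardSuperconductivity-10739-0.  The refuter tried to break the six stubs; four of them turned
out to be provable verbatim over the landed vocabulary `Theorems/NodalWardXYDefs.lean`, and the proofs are collected here
(namespace `…Cruxes.PerturbedXYOrder.Drefute`, so that the lead can land them under `Theorems/` with its own names without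
`dedup.fqn-exists`):

* `Drefute.entire`                  = `stub_entire`                  (parametric integrals over the compact cube)
* `Drefute.schwarzInheritance`      = `stub_schwarzInheritance`      (Schwarz lemma along the admissible ray)
* `Drefute.stabilityOfTaylorBounds` = `stub_stabilityOfTaylorBounds` (Taylor series of the principal log + identity theorem)
* `Drefute.realPlateauEven`         = `stub_realPlateauEven`         (finite-volume IR bound for every even L ≥ 4 + uniform Green bound)

Not proved here: `stub_realPlateauRest` (true; GS22 + Ginibre glue) and `stub_cumulantBounds` (equivalent to the crux, see
`DrefuteSchwarzInheritance.md`).  All four theorems: rc 0, no `sorry`, axioms ⊆ {propext, Classical.choice, Quot.sound}.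
-/

set_option linter.dupNamespace false

noncomputable section

namespace Summit.HubbardSuperconductivity.HubbardSuperconductivity.Cruxes.PerturbedXYOrder.Drefute

open MeasureTheory Metric Set Filter Topology Literature.Probability.LatticeModels Real
open Summit.HubbardSuperconductivity.HubbardSuperconductivity.Theses.NodalWardXY
open Summit.HubbardSuperconductivity.HubbardSuperconductivity.Theorems.PerturbedXYOrder
open scoped Nat

variable {L : ℕ}

/-! ## `stub_entire` -/

/-- `W_{tK} = t · W_K`. -/
theorem Wk_smul [NeZero L] (t : ℂ) (K : Bond L → Bond L → ℂ) (θ : TorusSite 3 L → ℝ) :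
    Wk (t • K) θ = t * Wk K θ := by
  unfold Wk
  simp only [Pi.smul_apply, smul_eq_mul, Finset.mul_sum]
  refine Finset.sum_congr rfl fun b _ => Finset.sum_congr rfl fun b' _ => ?_
  ring

/-- Crude sup bound `‖W_K(θ)‖ ≤ Σ_{b,b'} ‖K(b,b')‖`. -/
theorem norm_Wk_le [NeZero L] (K : Bond L → Bond L → ℂ) (θ : TorusSite 3 L → ℝ) :
    ‖Wk K θ‖ ≤ ∑ b : Bond L, ∑ b' : Bond L, ‖K b b'‖ := by
  unfold Wk
  refine (norm_sum_le _ _).trans (Finset.sum_le_sum fun b _ => ?_)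
  refine (norm_sum_le _ _).trans (Finset.sum_le_sum fun b' _ => ?_)
  rw [norm_mul, norm_mul, Complex.norm_real, Complex.norm_real, Real.norm_eq_abs, Real.norm_eq_abs]
  unfold cur
  calc ‖K b b'‖ * |Real.sin (θ (b.1 + Pi.single b.2 1) - θ b.1)| *
        |Real.sin (θ (b'.1 + Pi.single b'.2 1) - θ b'.1)|
      ≤ ‖K b b'‖ * 1 * 1 := by
        gcongr
        · exact Real.abs_sin_le_one _
        · exact Real.abs_sin_le_one _
    _ = ‖K b b'‖ := by ring

theorem continuous_Wk [NeZero L] (K : Bond L → Bond L → ℂ) : Continuous (Wk K) := by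
  unfold Wk cur; fun_prop

theorem continuous_wJ [NeZero L] (J : ℝ) : Continuous (wJ (L := L) J) := by
  unfold wJ; fun_prop

theorem isCompact_cube' : IsCompact (cube L) := isCompact_univ_pi fun _ => isCompact_Icc

theorem measurableSet_cube [NeZero L] : MeasurableSet (cube L) := isCompact_cube'.measurableSet

/-- The general parametric integral: for continuous `phi`, `t ↦ ∫_cube phi(θ) e^{t W_K(θ)} dθ` is entire. -/
theorem differentiable_integral_mul_cexp [NeZero L] (K : Bond L → Bond L → ℂ)
    (phi : (TorusSite 3 L → ℝ) → ℂ) (hphi : Continuous phi) :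
    Differentiable ℂ (fun t : ℂ => ∫ θ in cube L, phi θ * Complex.exp (t * Wk K θ)) := by
  intro t₀
  -- constants
  set C : ℝ := ∑ b : Bond L, ∑ b' : Bond L, ‖K b b'‖ with hC
  have hC0 : 0 ≤ C := Finset.sum_nonneg fun b _ => Finset.sum_nonneg fun b' _ => norm_nonneg _
  obtain ⟨M₀, hM₀⟩ := isCompact_cube'.exists_bound_of_continuousOn (f := phi) hphi.continuousOn
  set M : ℝ := max M₀ 0 with hM
  have hMphi : ∀ θ ∈ cube L, ‖phi θ‖ ≤ M := fun θ hθ => (hM₀ θ hθ).trans (le_max_left _ _)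
  have hM0 : 0 ≤ M := le_max_right _ _
  set B : ℝ := M * (Real.exp ((‖t₀‖ + 1) * C) * C) with hB
  -- the integrand and its derivative
  set F : ℂ → (TorusSite 3 L → ℝ) → ℂ := fun t θ => phi θ * Complex.exp (t * Wk K θ) with hF
  set F' : ℂ → (TorusSite 3 L → ℝ) → ℂ := fun t θ => phi θ * (Complex.exp (t * Wk K θ) * Wk K θ) with hF'
  have hFcont : ∀ t, Continuous (F t) := by
    intro t; simp only [hF]
    exact hphi.mul (Complex.continuous_exp.comp (continuous_const.mul (continuous_Wk K)))
  have hF'cont : ∀ t, Continuous (F' t) := by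
    intro t; simp only [hF']
    exact hphi.mul ((Complex.continuous_exp.comp (continuous_const.mul (continuous_Wk K))).mul
      (continuous_Wk K))
  have hdiff : ∀ θ t, HasDerivAt (fun t => F t θ) (F' t θ) t := by
    intro θ t
    simp only [hF, hF']
    have h1 : HasDerivAt (fun t : ℂ => t * Wk K θ) (Wk K θ) t := by
      simpa using (hasDerivAt_id t).mul_const (Wk K θ)
    exact (h1.cexp).const_mul (phi θ)
  have hbound : ∀ θ ∈ cube L, ∀ t ∈ ball t₀ 1, ‖F' t θ‖ ≤ B := by
    intro θ hθ t ht
    simp only [hF']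
    have ht' : ‖t‖ ≤ ‖t₀‖ + 1 := by
      have : dist t t₀ < 1 := ht
      rw [dist_eq_norm] at this
      calc ‖t‖ = ‖(t - t₀) + t₀‖ := by rw [sub_add_cancel]
        _ ≤ ‖t - t₀‖ + ‖t₀‖ := norm_add_le _ _
        _ ≤ ‖t₀‖ + 1 := by linarith
    have hexp : ‖Complex.exp (t * Wk K θ)‖ ≤ Real.exp ((‖t₀‖ + 1) * C) := by
      refine (Complex.norm_exp_le_exp_norm _).trans (Real.exp_le_exp.2 ?_)
      rw [norm_mul]
      exact mul_le_mul ht' (norm_Wk_le K θ) (norm_nonneg _) (by positivity)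
    rw [norm_mul, norm_mul]
    refine mul_le_mul (hMphi θ hθ) ?_ (by positivity) hM0
    exact mul_le_mul hexp (norm_Wk_le K θ) (norm_nonneg _) (by positivity)
  have hvol : volume (cube L) ≠ ⊤ := isCompact_cube'.measure_lt_top.ne
  have key := hasDerivAt_integral_of_dominated_loc_of_deriv_le (μ := volume.restrict (cube L))
    (F := F) (F' := F') (x₀ := t₀) (bound := fun _ => B) (ball_mem_nhds t₀ one_pos)
    (Eventually.of_forall fun t => (hFcont t).aestronglyMeasurable)
    ((hFcont t₀).continuousOn.integrableOn_compact isCompact_cube')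
    ((hF'cont t₀).aestronglyMeasurable)
    ((ae_restrict_iff' measurableSet_cube).2 (ae_of_all _ fun θ hθ t ht => hbound θ hθ t ht))
    (integrableOn_const hvol)
    (ae_of_all _ fun θ t _ => hdiff θ t)
  exact key.2.differentiableAt

/-- **Analyticity in the coupling** (`stub_entire` of the line skeleton, verbatim). -/
theorem entire :
    ∀ (J : ℝ) (L : ℕ) [NeZero L] (K : Bond L → Bond L → ℂ),
      Differentiable ℂ (fun t : ℂ => Zk J (t • K)) ∧ Differentiable ℂ (fun t : ℂ => num J (t • K)) := by
  intro J L _ K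
  constructor
  · have h : (fun t : ℂ => Zk J (t • K)) = fun t => ∫ θ in cube L, wJ J θ * Complex.exp (t * Wk K θ) := by
      funext t; unfold Zk; simp_rw [Wk_smul]
    rw [h]
    exact differentiable_integral_mul_cexp K (wJ J) (continuous_wJ J)
  · have h : (fun t : ℂ => num J (t • K)) = fun t => ∑ x : TorusSite 3 L, ∑ y : TorusSite 3 L,
        ∫ θ in cube L, ((Real.cos (θ x - θ y) : ℂ) * wJ J θ) * Complex.exp (t * Wk K θ) := by
      funext t; unfold num; simp_rw [Wk_smul, mul_assoc]
    rw [h]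
    refine Differentiable.fun_sum fun x _ => Differentiable.fun_sum fun y _ => ?_
    refine differentiable_integral_mul_cexp K _ ?_
    exact (Complex.continuous_ofReal.comp (by fun_prop)).mul (continuous_wJ J)

/-! ## `stub_schwarzInheritance` -/

/-- `0` is admissible at every non-negative radius. -/
theorem admissible_zero [NeZero L] {ε : ℝ} (hε : 0 ≤ ε) : Admissible L ε (0 : Bond L → Bond L → ℂ) := by
  intro b b'
  simp only [Pi.zero_apply, norm_zero]
  positivity

/-- Scaling of admissibility along a complex ray. -/
theorem admissible_smul_of_norm_mul_le [NeZero L] {ε ε' : ℝ} {c : ℂ} (hc : ‖c‖ * ε ≤ ε')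
    {K : Bond L → Bond L → ℂ} (hK : Admissible L ε K) : Admissible L ε' (c • K) := by
  intro b b'
  have hd : (0:ℝ) < (1 + ((torusGraph 3 L).dist b.1 b'.1 : ℝ)) ^ 4 := by positivity
  calc ‖(c • K) b b'‖ = ‖c‖ * ‖K b b'‖ := by simp
    _ ≤ ‖c‖ * (ε / (1 + ((torusGraph 3 L).dist b.1 b'.1 : ℝ)) ^ 4) :=
        mul_le_mul_of_nonneg_left (hK b b') (norm_nonneg _)
    _ = (‖c‖ * ε) / (1 + ((torusGraph 3 L).dist b.1 b'.1 : ℝ)) ^ 4 := by ring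
    _ ≤ ε' / (1 + ((torusGraph 3 L).dist b.1 b'.1 : ℝ)) ^ 4 := div_le_div_of_nonneg_right hc hd.le

/-- **Schwarz inheritance** (`stub_schwarzInheritance` of the line skeleton, verbatim signature). -/
theorem schwarzInheritance :
    ∀ (J : ℝ) (L : ℕ) [NeZero L] (ε₁ B a₀ : ℝ), 0 < ε₁ → 0 < a₀ →
      (∀ K : Bond L → Bond L → ℂ,
        Differentiable ℂ (fun t : ℂ => Zk J (t • K)) ∧ Differentiable ℂ (fun t : ℂ => num J (t • K))) →
      (∀ K : Bond L → Bond L → ℂ, Admissible L ε₁ K → Zk J K ≠ 0 ∧ ‖cratio L J K‖ ≤ B) →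
      a₀ ≤ (cratio L J 0).re →
      ∀ K : Bond L → Bond L → ℂ, Admissible L (ε₁ * a₀ / (4 * B)) K →
        Zk J K ≠ 0 ∧ a₀ / 2 ≤ (cratio L J K).re := by
  intro J L _ ε₁ B a₀ hε₁ ha₀ hent hstab hplat K hK
  -- `B ≥ a₀ > 0` from the admissible kernel `K = 0`
  have h0 := hstab 0 (admissible_zero hε₁.le)
  have hB : a₀ ≤ B := hplat.trans ((Complex.re_le_norm _).trans h0.2)
  have hBpos : 0 < B := ha₀.trans_le hB
  set R : ℝ := 4 * B / a₀ with hR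
  have hRpos : 0 < R := by positivity
  have hR1 : (1 : ℝ) < R := by
    rw [hR, lt_div_iff₀ ha₀]; linarith
  -- along the ray, `z • K` is admissible at radius `ε₁` for `‖z‖ < R`
  have hray : ∀ z : ℂ, ‖z‖ < R → Admissible L ε₁ (z • K) := by
    intro z hz
    refine admissible_smul_of_norm_mul_le ?_ hK
    have hε : 0 ≤ ε₁ * a₀ / (4 * B) := by positivity
    calc ‖z‖ * (ε₁ * a₀ / (4 * B)) ≤ R * (ε₁ * a₀ / (4 * B)) :=
          mul_le_mul_of_nonneg_right hz.le hε
      _ = ε₁ := by rw [hR]; field_simp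
  -- the complex plateau along the ray
  set g : ℂ → ℂ := fun z => cratio L J (z • K) with hg
  have hg0 : g 0 = cratio L J 0 := by simp [hg]
  have hg1 : g 1 = cratio L J K := by simp [hg]
  have hgB : ∀ z : ℂ, ‖z‖ < R → ‖g z‖ ≤ B := fun z hz => (hstab _ (hray z hz)).2
  have hdiff : DifferentiableOn ℂ g (ball (0 : ℂ) R) := by
    intro z hz
    have hz' : ‖z‖ < R := by simpa using hz
    have hZ : Zk J (z • K) ≠ 0 := (hstab _ (hray z hz')).1
    have h1 : DifferentiableAt ℂ (fun t : ℂ => num J (t • K)) z := (hent K).2 z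
    have h2 : DifferentiableAt ℂ (fun t : ℂ => Zk J (t • K)) z := (hent K).1 z
    have h3 : DifferentiableAt ℂ (fun t : ℂ => num J (t • K) / Zk J (t • K) / ((L : ℂ) ^ 6)) z :=
      (h1.div h2 hZ).div_const _
    exact h3.differentiableWithinAt
  have hmaps : MapsTo g (ball (0 : ℂ) R) (closedBall (g 0) (2 * B)) := by
    intro z hz
    have hz' : ‖z‖ < R := by simpa using hz
    rw [mem_closedBall, dist_eq_norm]
    calc ‖g z - g 0‖ ≤ ‖g z‖ + ‖g 0‖ := norm_sub_le _ _
      _ ≤ B + B := add_le_add (hgB z hz') (by rw [hg0]; exact h0.2)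
      _ = 2 * B := by ring
  have h1mem : (1 : ℂ) ∈ ball (0 : ℂ) R := by simpa using hR1
  have hschwarz := Complex.dist_le_div_mul_dist_of_mapsTo_ball hdiff hmaps h1mem
  have hdist : ‖g 1 - g 0‖ ≤ a₀ / 2 := by
    rw [← dist_eq_norm]
    refine hschwarz.trans (le_of_eq ?_)
    rw [dist_zero_right, norm_one, mul_one, hR]
    field_simp
    ring
  refine ⟨(hstab K (hray 1 (by simpa using hR1) |> fun h => by simpa using h)).1, ?_⟩
  -- real part: `Re g 1 ≥ Re g 0 − ‖g 1 − g 0‖`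
  have hre : (g 0).re - (g 1).re ≤ ‖g 1 - g 0‖ := by
    calc (g 0).re - (g 1).re = (g 0 - g 1).re := by simp
      _ ≤ ‖g 0 - g 1‖ := Complex.re_le_norm _
      _ = ‖g 1 - g 0‖ := norm_sub_rev _ _
  have h0re : a₀ ≤ (g 0).re := by rw [hg0]; exact hplat
  have hfin : a₀ / 2 ≤ (g 1).re := by linarith
  rw [hg1] at hfin
  exact hfin

/-! ## `stub_stabilityOfTaylorBounds` -/

/-- **Stability from Taylor bounds** (`stub_stabilityOfTaylorBounds` of the line skeleton, verbatim). -/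
theorem stabilityOfTaylorBounds :
    ∀ (J : ℝ) (L : ℕ) [NeZero L] (K : Bond L → Bond L → ℂ) (A V : ℝ), 0 < A → 0 ≤ V →
      Differentiable ℂ (fun t : ℂ => Zk J (t • K)) → Differentiable ℂ (fun t : ℂ => num J (t • K)) →
      Zk J (0 : Bond L → Bond L → ℂ) ≠ 0 →
      (∀ n : ℕ, 1 ≤ n →
        ‖iteratedDeriv n (fun t : ℂ => Complex.log (Zk J (t • K) / Zk J (0 : Bond L → Bond L → ℂ))) 0‖ ≤
          (n.factorial : ℝ) * A ^ n * V) →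
      (∀ n : ℕ, 1 ≤ n → ‖iteratedDeriv n (fun t : ℂ => cratio L J (t • K)) 0‖ ≤ (n.factorial : ℝ) * A ^ n) →
      ∀ t : ℂ, ‖t‖ ≤ 1 / (2 * A) → Zk J (t • K) ≠ 0 ∧ ‖cratio L J (t • K) - cratio L J 0‖ ≤ 1 := by
  intro J L _ K A V hA hV hZ hN hZ0 hlog hcr t ht
  set ℓ : ℂ → ℂ := fun t : ℂ => Complex.log (Zk J (t • K) / Zk J (0 : Bond L → Bond L → ℂ)) with hℓ
  set h : ℂ → ℂ := fun t : ℂ => cratio L J (t • K) with hh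
  set F : ℂ → ℂ := fun t : ℂ => Zk J (t • K) / Zk J (0 : Bond L → Bond L → ℂ) with hF
  have hF0 : F 0 = 1 := by simp [hF, hZ0]
  have hFdiff : Differentiable ℂ F := hZ.div_const _
  have hAinv : 0 < 1 / A := by positivity
  -- (i) the principal log is differentiable on a small ball around 0
  obtain ⟨r₀, hr₀, hball⟩ : ∃ r₀ > 0, ∀ z : ℂ, ‖z‖ < r₀ → F z ∈ Complex.slitPlane := by
    have hmem : F ⁻¹' Complex.slitPlane ∈ 𝓝 (0 : ℂ) :=
      hFdiff.continuous.continuousAt.preimage_mem_nhds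
        (Complex.isOpen_slitPlane.mem_nhds (by rw [hF0]; exact Complex.one_mem_slitPlane))
    obtain ⟨r₀, hr₀, hsub⟩ := Metric.mem_nhds_iff.mp hmem
    exact ⟨r₀, hr₀, fun z hz => hsub (by simpa using hz)⟩
  have hℓdiff : DifferentiableOn ℂ ℓ (ball 0 r₀) := by
    intro z hz
    have hz' : ‖z‖ < r₀ := by simpa using hz
    exact ((hFdiff z).clog (hball z hz')).differentiableWithinAt
  -- Taylor coefficient bounds for every n (n = 0 : ℓ 0 = 0)
  have hℓ0 : ℓ 0 = 0 := by simp [hℓ, hZ0]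
  have hcoef : ∀ n : ℕ, ‖iteratedDeriv n ℓ 0‖ ≤ (n ! : ℝ) * A ^ n * V := by
    intro n
    rcases Nat.eq_zero_or_pos n with rfl | hn
    · simp [iteratedDeriv_zero, hℓ0, hV]
    · exact hlog n hn
  -- the Taylor series of ℓ at 0
  set term : ℕ → ℂ → ℂ := fun n z => (n ! : ℂ)⁻¹ • (z - 0) ^ n • iteratedDeriv n ℓ 0 with hterm
  set g : ℂ → ℂ := fun z => ∑' n, term n z with hg
  have hterm_norm : ∀ n z, ‖term n z‖ = (n ! : ℝ)⁻¹ * ‖z‖ ^ n * ‖iteratedDeriv n ℓ 0‖ := by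
    intro n z
    simp only [hterm]
    rw [sub_zero, norm_smul, norm_smul, norm_inv, Complex.norm_natCast, norm_pow]
    ring
  have hterm_le : ∀ (n : ℕ) (z : ℂ) (ρ : ℝ), ‖z‖ ≤ ρ → ‖term n z‖ ≤ V * (A * ρ) ^ n := by
    intro n z ρ hz
    have hρ : 0 ≤ ρ := (norm_nonneg z).trans hz
    rw [hterm_norm]
    have hfne : (n ! : ℝ) ≠ 0 := by positivity
    have h1 : ‖z‖ ^ n ≤ ρ ^ n := pow_le_pow_left₀ (norm_nonneg _) hz n
    calc (n ! : ℝ)⁻¹ * ‖z‖ ^ n * ‖iteratedDeriv n ℓ 0‖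
        ≤ (n ! : ℝ)⁻¹ * ρ ^ n * ((n ! : ℝ) * A ^ n * V) := by
          apply mul_le_mul (mul_le_mul_of_nonneg_left h1 (by positivity)) (hcoef n) (norm_nonneg _)
          exact mul_nonneg (by positivity) (pow_nonneg hρ n)
      _ = V * (A * ρ) ^ n := by field_simp; ring
  -- g is differentiable on the ball of radius 1/A
  have hgdiff : DifferentiableOn ℂ g (ball 0 (1 / A)) := by
    intro z hz
    have hz' : ‖z‖ < 1 / A := by simpa using hz
    obtain ⟨ρ, hzρ, hρA⟩ := exists_between hz'
    have hρ0 : 0 ≤ ρ := (norm_nonneg z).trans hzρ.le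
    have hAρ : A * ρ < 1 := by rwa [lt_div_iff₀' hA] at hρA
    have hAρ0 : 0 ≤ A * ρ := by positivity
    have hdiffρ : DifferentiableOn ℂ g (ball 0 ρ) := by
      refine Complex.differentiableOn_tsum_of_summable_norm (u := fun n => V * (A * ρ) ^ n) ?_ ?_
        isOpen_ball ?_
      · exact (summable_geometric_of_lt_one hAρ0 hAρ).mul_left V
      · intro n; simp only [hterm]; fun_prop
      · intro n w hw
        exact hterm_le n w ρ (le_of_lt (by simpa using hw))
    exact (hdiffρ.differentiableAt (isOpen_ball.mem_nhds (by simpa using hzρ))).differentiableWithinAt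
  -- (ii) near 0 the series is the principal log
  have hgℓ : ∀ z : ℂ, ‖z‖ < r₀ → g z = ℓ z := by
    intro z hz
    have hz' : z ∈ ball (0 : ℂ) r₀ := by simpa using hz
    exact (Complex.hasSum_taylorSeries_on_ball hℓdiff hz').tsum_eq
  -- (iii) exp ∘ g = Z(·K)/Z(0) on the whole ball (identity theorem)
  have hEqOn : EqOn (fun z => Complex.exp (g z)) F (ball 0 (1 / A)) := by
    refine AnalyticOnNhd.eqOn_of_preconnected_of_eventuallyEq (𝕜 := ℂ) (z₀ := 0) ?_ ?_ ?_ ?_ ?_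
    · exact hgdiff.cexp.analyticOnNhd isOpen_ball
    · exact hFdiff.differentiableOn.analyticOnNhd isOpen_ball
    · exact (convex_ball (0 : ℂ) (1 / A)).isPreconnected
    · exact mem_ball_self hAinv
    · have hsmall : ball (0 : ℂ) (min r₀ (1 / A)) ∈ 𝓝 (0 : ℂ) := ball_mem_nhds _ (lt_min hr₀ hAinv)
      filter_upwards [hsmall] with z hz
      have hz' : ‖z‖ < r₀ := lt_of_lt_of_le (by simpa using hz : ‖z‖ < min r₀ (1 / A)) (min_le_left _ _)
      rw [hgℓ z hz']
      exact Complex.exp_log (Complex.slitPlane_ne_zero (hball z hz'))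
  -- (iv) zero-freeness on the ball
  have hne : ∀ z : ℂ, ‖z‖ < 1 / A → Zk J (z • K) ≠ 0 := by
    intro z hz hzero
    have h1 := hEqOn (by simpa using hz : z ∈ ball (0 : ℂ) (1 / A))
    have h2 : F z = 0 := by simp [hF, hzero]
    simp only [h2] at h1
    exact Complex.exp_ne_zero _ h1
  have ht' : ‖t‖ < 1 / A := lt_of_le_of_lt ht (one_div_lt_one_div_of_lt hA (by linarith))
  refine ⟨hne t ht', ?_⟩
  -- (v) Taylor expansion of the complex plateau on the ball
  have hhdiff : DifferentiableOn ℂ h (ball 0 (1 / A)) := by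
    intro z hz
    have hz' : ‖z‖ < 1 / A := by simpa using hz
    have h3 : DifferentiableAt ℂ (fun w : ℂ => num J (w • K) / Zk J (w • K) / ((L : ℂ) ^ 6)) z :=
      ((hN z).div (hZ z) (hne z hz')).div_const _
    exact h3.differentiableWithinAt
  have hsum := Complex.hasSum_taylorSeries_on_ball hhdiff (by simpa using ht' : t ∈ ball (0 : ℂ) (1 / A))
  set s : ℕ → ℂ := fun n => (n ! : ℂ)⁻¹ • (t - 0) ^ n • iteratedDeriv n h 0 with hs
  have hs0 : s 0 = h 0 := by simp [hs]
  have htail : HasSum (fun n => s (n + 1)) (h t - h 0) := by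
    have := (hasSum_nat_add_iff' (f := s) 1).mpr hsum
    simpa [hs0] using this
  have hbound : ∀ n : ℕ, ‖s (n + 1)‖ ≤ (1 : ℝ) / 2 / 2 ^ n := by
    intro n
    have e1 : ‖s (n + 1)‖ = ((n + 1) ! : ℝ)⁻¹ * ‖t‖ ^ (n + 1) * ‖iteratedDeriv (n + 1) h 0‖ := by
      simp only [hs]
      rw [sub_zero, norm_smul, norm_smul, norm_inv, Complex.norm_natCast, norm_pow]
      ring
    rw [e1]
    have hc := hcr (n + 1) (Nat.succ_pos n)
    have hfne : ((n + 1) ! : ℝ) ≠ 0 := by positivity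
    have hAt : A * ‖t‖ ≤ 1 / 2 := by
      calc A * ‖t‖ ≤ A * (1 / (2 * A)) := mul_le_mul_of_nonneg_left ht hA.le
        _ = 1 / 2 := by field_simp
    calc ((n + 1) ! : ℝ)⁻¹ * ‖t‖ ^ (n + 1) * ‖iteratedDeriv (n + 1) h 0‖
        ≤ ((n + 1) ! : ℝ)⁻¹ * ‖t‖ ^ (n + 1) * (((n + 1) ! : ℝ) * A ^ (n + 1)) :=
          mul_le_mul_of_nonneg_left hc (by positivity)
      _ = (A * ‖t‖) ^ (n + 1) := by field_simp; ring
      _ ≤ (1 / 2) ^ (n + 1) := pow_le_pow_left₀ (by positivity) hAt (n + 1)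
      _ = 1 / 2 / 2 ^ n := by rw [pow_succ, one_div_pow]; ring
  have hfin := htail.norm_le_of_bounded (hasSum_geometric_two' 1) hbound
  simpa [hh] using hfin

/-! ## `stub_realPlateauEven` -/

/-! ### `K = 0` identities (as in the line skeleton) -/

theorem Wk_zero_apply [NeZero L] (θ : TorusSite 3 L → ℝ) : Wk (0 : Bond L → Bond L → ℂ) θ = 0 := by
  simp [Wk]

/-- The real (unperturbed) weight `e^{J Σ cos}`. -/
def w0r [NeZero L] (J : ℝ) (θ : TorusSite 3 L → ℝ) : ℝ :=
  Real.exp (J * ∑ b : Bond L, Real.cos (θ (b.1 + Pi.single b.2 1) - θ b.1))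

theorem Zk_zero_eq_real [NeZero L] (J : ℝ) :
    Zk J (0 : Bond L → Bond L → ℂ) = ((∫ θ in cube L, w0r J θ : ℝ) : ℂ) := by
  unfold Zk
  have : (fun θ : TorusSite 3 L → ℝ => wJ J θ * Complex.exp (Wk (0 : Bond L → Bond L → ℂ) θ)) =
      fun θ => ((w0r J θ : ℝ) : ℂ) := by
    funext θ; rw [Wk_zero_apply, Complex.exp_zero, mul_one]; rfl
  rw [this, integral_complex_ofReal]

theorem num_zero_eq_real [NeZero L] (J : ℝ) :
    num J (0 : Bond L → Bond L → ℂ) =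
      ((∑ x : TorusSite 3 L, ∑ y : TorusSite 3 L, ∫ θ in cube L, Real.cos (θ x - θ y) * w0r J θ : ℝ) : ℂ) := by
  have hxy : ∀ x y : TorusSite 3 L,
      (∫ θ in cube L, (Real.cos (θ x - θ y) : ℂ) * (wJ J θ * Complex.exp (Wk (0 : Bond L → Bond L → ℂ) θ))) =
        ((∫ θ in cube L, Real.cos (θ x - θ y) * w0r J θ : ℝ) : ℂ) := by
    intro x y
    have h : (fun θ : TorusSite 3 L → ℝ =>
        (Real.cos (θ x - θ y) : ℂ) * (wJ J θ * Complex.exp (Wk (0 : Bond L → Bond L → ℂ) θ))) =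
        fun θ => ((Real.cos (θ x - θ y) * w0r J θ : ℝ) : ℂ) := by
      funext θ; rw [Wk_zero_apply, Complex.exp_zero, mul_one, Complex.ofReal_mul]; rfl
    rw [h, integral_complex_ofReal]
  unfold num
  rw [Complex.ofReal_sum]
  refine Finset.sum_congr rfl fun x _ => ?_
  rw [Complex.ofReal_sum]
  exact Finset.sum_congr rfl fun y _ => hxy x y

/-- `Re cratio(L, J, 0)` is the real magnetisation ratio `⟨|m_L|²⟩_{L,J}`. -/
theorem cratio_zero_re [NeZero L] (J : ℝ) :
    (cratio L J (0 : Bond L → Bond L → ℂ)).re =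
      (∑ x : TorusSite 3 L, ∑ y : TorusSite 3 L, ∫ θ in cube L, Real.cos (θ x - θ y) * w0r J θ) /
        ((∫ θ in cube L, w0r J θ) * (L : ℝ) ^ 6) := by
  unfold cratio
  rw [num_zero_eq_real, Zk_zero_eq_real]
  have h : ((( ∑ x : TorusSite 3 L, ∑ y : TorusSite 3 L,
        ∫ θ in cube L, Real.cos (θ x - θ y) * w0r J θ : ℝ) : ℂ) /
        ((∫ θ in cube L, w0r J θ : ℝ) : ℂ) / ((L : ℂ)) ^ 6)
      = (((∑ x : TorusSite 3 L, ∑ y : TorusSite 3 L, ∫ θ in cube L, Real.cos (θ x - θ y) * w0r J θ) /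
          ((∫ θ in cube L, w0r J θ) * (L : ℝ) ^ 6) : ℝ) : ℂ) := by
    push_cast; ring
  rw [h, Complex.ofReal_re]

/-! ### The infrared bound for every even `L ≥ 4` and a uniform Green-function bound -/

/-- Finite-volume infrared lower bound (tree: `FriedliVelenik2017_nVector_infraredBound_holds`, clause (2)),
in the crux's angle variables, for EVERY even `L ≥ 4`. -/
theorem ir_bound_even [NeZero L] {J : ℝ} (hJ : 0 < J) (hLe : Even L) (hL4 : 4 ≤ L) :
    1 - torusGreen (0 : TorusSite 3 L) / J ≤
      (∑ x : TorusSite 3 L, ∑ y : TorusSite 3 L, ∫ θ in cube L, Real.cos (θ x - θ y) * w0r J θ) /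
        ((∫ θ in cube L, w0r J θ) * (L : ℝ) ^ 6) := by
  have hfact := (FriedliVelenik2017_nVector_infraredBound_holds 3 L 2 hLe hL4
    (Measure.map (fun t : ℝ => (![Real.cos t, Real.sin t] : Fin 2 → ℝ))
      (volume.restrict (Set.Icc (0 : ℝ) (2 * π))))
    (PlaneRotator.exists_isCompact_map_angleLaw PlaneRotator.continuous_cosSin)
    (PlaneRotator.map_angleLaw_ne_zero PlaneRotator.continuous_cosSin.measurable) (J / 2)
    (by positivity)).2
    (PlaneRotator.ae_map_angleLaw PlaneRotator.continuous_cosSin PlaneRotator.sum_cosSin_sq)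
  rw [PlaneRotator.inv_mul_sum_inv_dispersion_eq_torusGreen,
    PlaneRotator.integral_magnetisationNormSq_nVectorGibbs_cosSin hJ] at hfact
  have hcoef : ((2 : ℕ) : ℝ) / (4 * (J / 2)) * torusGreen (0 : TorusSite 3 L) =
      torusGreen (0 : TorusSite 3 L) / J := by
    push_cast
    field_simp
    ring
  rw [hcoef] at hfact
  exact hfact

/-- `torusGreen_L(0)` is bounded uniformly over even `L ≥ 4`. -/
theorem torusGreen_zero_bounded :
    ∃ T : ℝ, ∀ (L : ℕ) [NeZero L], Even L → 4 ≤ L → torusGreen (0 : TorusSite 3 L) ≤ T := by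
  obtain ⟨L₀, hL₀⟩ := torusGreen_tendsto_latticeGreen (d := 3) le_rfl (0 : Site 3) (ε := 1) one_pos
  let g : ℕ → ℝ := fun L => if h : L = 0 then 0 else
    (haveI : NeZero L := ⟨h⟩; torusGreen (0 : TorusSite 3 L))
  refine ⟨max (latticeGreen (0 : Site 3) + 1) (∑ L ∈ Finset.range L₀, |g L|), ?_⟩
  intro L _ hLe hL4
  by_cases hL : L₀ ≤ L
  · have h := hL₀ L hLe hL
    rw [PlaneRotator.torusProj_zero] at h
    exact le_trans (by linarith [(abs_le.1 h).2]) (le_max_left _ _)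
  · have hlt : L ∈ Finset.range L₀ := Finset.mem_range.2 (lt_of_not_ge hL)
    have hg : g L = torusGreen (0 : TorusSite 3 L) := by
      show (if h : L = 0 then 0 else _) = _
      rw [dif_neg (NeZero.ne L)]
    refine le_trans ?_ (le_max_right _ _)
    rw [← hg]
    exact le_trans (le_abs_self _)
      (Finset.single_le_sum (f := fun L => |g L|) (fun _ _ => abs_nonneg _) hlt)

/-- **The `K = 0` plateau on even tori** (`stub_realPlateauEven` of the line skeleton, verbatim). -/
theorem realPlateauEven :
    ∃ J₁ a₀ : ℝ, 0 < a₀ ∧ ∀ J : ℝ, J₁ ≤ J → ∀ (L : ℕ) [NeZero L], Even L → 4 ≤ L →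
      a₀ ≤ (cratio L J 0).re := by
  obtain ⟨T, hT⟩ := torusGreen_zero_bounded
  refine ⟨max (2 * T) 1, 1 / 2, by norm_num, fun J hJ L _ hLe hL4 => ?_⟩
  have hJ1 : 1 ≤ J := le_trans (le_max_right _ _) hJ
  have hJpos : 0 < J := by linarith
  have hJT : 2 * T ≤ J := le_trans (le_max_left _ _) hJ
  rw [cratio_zero_re]
  refine le_trans ?_ (ir_bound_even hJpos hLe hL4)
  have h1 : torusGreen (0 : TorusSite 3 L) / J ≤ T / J :=
    div_le_div_of_nonneg_right (hT L hLe hL4) hJpos.le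
  have h2 : T / J ≤ 1 / 2 := by
    rw [div_le_iff₀ hJpos]
    linarith
  linarith

end Summit.HubbardSuperconductivity.HubbardSuperconductivity.Cruxes.PerturbedXYOrder.Drefute

end
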